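import Summits.AtomisticToContinuum.BoseEinsteinCondensation.Theses.BECZeroCrossingDilute
import Summits.AtomisticToContinuum.BoseEinsteinCondensation.Theorems.BECZeroCrossingDiluteNearIsotropicDiluteBECPenalisedPerron
import Literature.MathematicalPhysics.QuantumLattice.SpinChainsAkltCorrelationProofs
import HarnessLib

/-!
# Evidence (lead, cycle 1): the remaining stub C of line `birth` is NO STRONGER than the crux

`thermodynamicWindow_of_crux : NearIsotropicDiluteBEC → (registered signature of stub_thermodynamicWindow)`:
given the crux, stub C follows for EVERY `κ` (its window hypothesis `κL ≤ (1−Δ)N` and the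
nonnegativity hypothesis are not even used), because by the landed Perron stub A the tracial
ground-state functional of `K_L(N,Δ)` is the vector state of any unit ground vector. Together with the
skeleton (`C ∧ landed A,B ⇒ crux`) this certifies that `stub_thermodynamicWindow` is crux-EQUIVALENT:
promoting it (outcome `promote-stub`) loses nothing and a refuter need not attack it separately.
Workfile / evidence only (it concludes a stub signature from the crux, so it is not a `Theorems/` file).
-/

noncomputable section

namespace Summit.AtomisticToContinuum.BoseEinsteinCondensation.Cruxes.NearIsotropicDiluteBEC.Birth

open scoped BigOperators Matrix ComplexOrder
open Literature.MathematicalPhysics.QuantumLattice Literature.Probability.LatticeModels Matrix Complex Finset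

/-- **Crux ⇒ stub C.** The registered signature of `stub_thermodynamicWindow` follows from
`NearIsotropicDiluteBEC` (with `ε ↦ min ε 1`, `ν₀ ↦ min ν₀ 1`, any `κ`), via stub A
(`stub_penalisedPerron`: unique ground state) and `groundStateFunctional_eq_of_hasUniqueGroundState`.
[folklore] -/
theorem thermodynamicWindow_of_crux
    (hX : Summit.AtomisticToContinuum.BoseEinsteinCondensation.Theses.BECZeroCrossingDilute.NearIsotropicDiluteBEC) :
    ∀ κ : ℝ, 0 < κ → ∃ ε ν₀ : ℝ, 0 < ε ∧ 0 < ν₀ ∧ ∀ (L : ℕ) [NeZero L], 2 ≤ L →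
      ∀ N : ℕ, (N : ℝ) ≤ ν₀ * (L : ℝ) ^ 3 → ∀ Δ : ℝ, 1 - ε ≤ Δ → Δ ≤ 1 →
      κ * (L : ℝ) ≤ (1 - Δ) * (N : ℝ) →
      ∀ ψ : TensorIndex (TorusSite 3 L) 2 → ℂ,
        ψ ∈ (xxzHamiltonian 1 (torusGraph 3 L) (-1) Δ +
          (((3 + 1) * L ^ 3 : ℕ) : ℂ) • (totalSpin 1 2 + ((L : ℂ) ^ 3 / 2 - (N : ℂ)) • 1) ^ 2).groundSpace →
        ((totalSpin 1 2 : Op (TorusSite 3 L) 2) + ((L : ℂ) ^ 3 / 2 - (N : ℂ)) • 1) *ᵥ ψ = 0 → star ψ ⬝ᵥ ψ = 1 →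
        (∀ σ, ψ σ = ((‖ψ σ‖ : ℝ) : ℂ)) →
        (N : ℝ) * ((L : ℝ) ^ 3 - N + 1) ≤
          2 * ((star ψ ⬝ᵥ ((totalSpin 1 0 : Op (TorusSite 3 L) 2) * totalSpin 1 0 + totalSpin 1 1 * totalSpin 1 1) *ᵥ ψ).re +
            N - (L : ℝ) ^ 3 / 2) := by
  obtain ⟨ε, ν₀, hε, hν₀, hP⟩ := hX
  intro κ _hκ
  refine ⟨min ε 1, min ν₀ 1, lt_min hε one_pos, lt_min hν₀ one_pos, ?_⟩
  intro L _ hL N hN Δ hΔ1 hΔ2 _hwin ψ hψmem _hψpen hψ1 _hψnn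
  have hL3 : (0 : ℝ) ≤ (L : ℝ) ^ 3 := by positivity
  have hNν : (N : ℝ) ≤ ν₀ * (L : ℝ) ^ 3 :=
    hN.trans (mul_le_mul_of_nonneg_right (min_le_left _ _) hL3)
  have hNV' : (N : ℝ) ≤ (L : ℝ) ^ 3 := by
    have h := hN.trans (mul_le_mul_of_nonneg_right (min_le_right _ _) hL3)
    linarith
  have hNV : N ≤ L ^ 3 := by exact_mod_cast hNV'
  have hΔε : 1 - ε ≤ Δ := le_trans (by linarith [min_le_left ε 1]) hΔ1
  have hΔ0 : 0 ≤ Δ := le_trans (by linarith [min_le_right ε 1]) hΔ1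
  -- the crux at (L, N, Δ)
  have key := hP L hL N hNν Δ hΔε hΔ2
  -- uniqueness of the ground state (stub A) makes the functional the vector state of ψ
  obtain ⟨φ, -, hφ1, -, hφmem, hφspan⟩ := stub_penalisedPerron L hL N hNV Δ hΔ0 hΔ2
  set Kp : Op (TorusSite 3 L) 2 := xxzHamiltonian 1 (torusGraph 3 L) (-1) Δ +
    (((3 + 1) * L ^ 3 : ℕ) : ℂ) • (totalSpin 1 2 + ((L : ℂ) ^ 3 / 2 - (N : ℂ)) • 1) ^ 2 with hKp
  have hφ0 : φ ≠ 0 := by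
    rintro rfl
    simp at hφ1
  have hψ0 : ψ ≠ 0 := by
    rintro rfl
    simp at hψ1
  have hspan : Kp.groundSpace = ℂ ∙ φ := by
    refine le_antisymm ?_ ?_
    · intro χ hχ
      obtain ⟨c, hc⟩ := hφspan χ hχ
      rw [Submodule.mem_span_singleton]
      exact ⟨c, hc.symm⟩
    · rw [Submodule.span_le, Set.singleton_subset_iff]
      exact hφmem
  have huniq : Kp.HasUniqueGroundState := by
    show Module.finrank ℂ Kp.groundSpace = 1
    rw [hspan]
    exact finrank_span_singleton hφ0
  have hω : Kp.groundStateFunctional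
      ((totalSpin 1 0 : Op (TorusSite 3 L) 2) * totalSpin 1 0 + totalSpin 1 1 * totalSpin 1 1) =
      star ψ ⬝ᵥ ((totalSpin 1 0 : Op (TorusSite 3 L) 2) * totalSpin 1 0 + totalSpin 1 1 * totalSpin 1 1) *ᵥ ψ := by
    rw [groundStateFunctional_eq_of_hasUniqueGroundState huniq hψmem hψ0, hψ1, div_one]
  rw [hω] at key
  exact key

end Summit.AtomisticToContinuum.BoseEinsteinCondensation.Cruxes.NearIsotropicDiluteBEC.Birth

end
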